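import Summits.QuantumFields.YangMills.Theorems.UnitScaleTiltProp7OneFormAgmonConj
import Literature.MathematicalPhysics.QuantumFieldTheory.Balaban1983to89.Beta.CombesThomasForm
import Literature.Analysis.ODE.OneSidedComparison
import HarnessLib

/-!
# Route `UnitScaleTilt`, crux K1 «MinimiserStabilityRegPr» (stmt-QuantumFields-19200), EX face S45 — (L3′b)-VALUE, ONE-FORM STOREY, pen (P-1FA) «ONE-FORM AGMON», FILE A2e:
# **THE WEIGHT ROWS OF `hVconj` AT THE BLOCK-DISTANCE EXPONENTIAL WEIGHTS** — for `w = e^{φ}` with px12's fine-Lipschitz row `|φ x − φ x′| ≤ μη·tdist x x′`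
# (✓`Prop7BlockDistanceWeights.exists_blockDistanceWeight` (i′)), the (Q) read-set ratios and the (P) far ratios of A2c ✓`Prop7OneFormAgmonConj.hVconj_of_letters` are THEOREMS of
# the torus geometry (`tdist x x′ ≤ ℓ·tdist(Bx, Bx′) + d(ℓ − 1)`, §1), so the chair's A4 ✓`Prop7OneFormAgmonExp.agmon_oneForm_exp`∕`blockDecay_oneForm_of_letters` receive their
# `hVconj` from the member letters `hk` (h349 kernel), `hQ` (`‖Q_k‖`), `hslot` alone (§3)

Cell `ym3-torus` (HUMAN RULING D-0037; rung R3 = SU(2) YM₃ on T³ — NOT d = 4, NOT infinite volume, NOT a mass gap, NOT Clay).  Width seat `ym3-torus-px21` (gen 14).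
THEOREMS ONLY (0 `def`, 0 `sorry`); `--supports stmt-QuantumFields-19200 --as helper`; count-neutral.

WHAT IS PROVED (ns `Summit.QuantumFields.YangMills.Theorems.Prop7OneFormAgmonWeights`).
* §1 ★ `tdist_le_iterBlockOf` — EXPANSION of the `k`-fold block map: `tdist x y ≤ L^k·tdist(B^k x, B^k y) + d·(L^k − 1)` (lit-side ✓`CollarCount.dist_le_coarse` per coordinate at modulus
  ratio `L^k`, ✓`val_iterBlockOf`; the twin of px12's contraction ✓`tdist_iterBlockOf_le`); `one_add_le_exp_div` (`1 + T ≤ e^{βT}∕β`, `0 < β ≤ 1`; with lit ✓`Literature.Analysis.ODE.exp_sub_one_le_mul_exp`).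
* §2 for a fine-Lipschitz `φ` (`|φ x − φ x′| ≤ μη·tdist x x′`, `0 ≤ μ`): `abs_sub_le_coarse` (`|φ x − φ x′| ≤ μ·(tdist(Bx,Bx′) + d)`, `ηℓ = 1`), ★ `far_ratio_exp_le`
  (`|e^{φ x}∕e^{φ x′} − 1| ≤ (μ·d·e^{μd}∕β)·e^{(μ+β)·tdist(Bx,Bx′)}` for `0 < β ≤ 1` — the `hwfar` row), ★ `readSet_ratio_exp_le` (`|e^{φ(b₋)}∕e^{φ(x_r ĉ)} − 1| ≤ e^{μ(d+1)} − 1` and its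
  reciprocal on the read set of `ĉ`, for reference sites in the source block — the `hρQ` row).
* §3 ★★★ `hVconj_exp_of_letters` — A2c at `w := e^{φ}`: `RegPr` + windows, `0 ≤ a`, the per-bond slope `|φ(b₊) − φ(b₋)| ≤ θ` (A4's `hφ`), the fine-Lipschitz row, reference sites `x_r`
  in the source blocks, `0 < β ≤ 1`, `μ + β < μ′`, and the three member letters `hk` (`Ck`, `μ′`), `hQ` (`C_Q`), `hslot` (`θ_S`) ⟹ A4's `hVconj` TEXT (`Real.exp (φ b.src) • X b` ∕
  `(Real.exp (φ b.src))⁻¹ • X b`) with `θ_V = a·(2√κ²C_Q + κ²) + √2·Ck·(μ d e^{μd}∕β)·(d(L^d)^{K−n}(2(1+1∕(μ′−μ−β)))³) + θ_S + 32√2·ε₀·d·6^d·(1+e^{2θ})`, `κ² = 216(e^{μ(d+1)}−1)²(cB∕(c₀ℓ³))`.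
HYP-SAT (★★OWNER RULING №42): the φ-rows are px12 ✓`exists_blockDistanceWeight` (i)∕(i′) (`θ = μη`); `x_r` = any site of the source block (e.g. its corner); `hk`∕`hQ`∕`hslot` as A2c;
nothing eventual; no hypothesis restates a conclusion.  HONEST SCOPE.  Geometry + instantiation; nothing of the ten EX rows, `hT`, EX or the crux is proved here; the Yang–Mills mass gap is NOT proved.

References: T. Bałaban, CMP **99** (1985) 389–434 [Balaban1985BackgroundPropagators] (Thm 3.1 (3.46) p.398, (3.49) p.399); CMP **98** (1985) 17–51 [Balaban1985Averaging] ((2) p.17);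
S. Agmon, *Lectures on exponential decay* (Princeton 1982) Ch. 1 [Agmon1982].
-/

set_option autoImplicit false

noncomputable section

open scoped BigOperators Matrix.Norms.L2Operator InnerProductSpace ComplexConjugate

namespace Summit.QuantumFields.YangMills.Theorems.Prop7OneFormAgmonWeights

open Literature.MathematicalPhysics.QuantumFieldTheory.Balaban1983to89
open Literature.MathematicalPhysics.QuantumFieldTheory.Balaban1983to89.T3ContinuumYM3Torus
open T3SectALandauChart (eta eta_pos bgUnits formComp)
open T3PrintedRegularMinimiser (RegPr)
open T3PrintedRegularOrbits (sites_eq)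
open T3LevelShift (bondShift)
open B9TorusCalculus (torusT)
open B9Eq310Hermitian (deltaPrimeOp)
open B11Eq135Weitzenbock (curvOp)
open B11Eq103H1Complex (SiteL2K BondL2K)
open B5Eq118OneStroke (iterBlockOf val_iterBlockOf)
open B3Taylor310LocalRemainder (tdist_comm tdist_triangle)
open Summit.QuantumFields.Balaban3D.Proofs.CollarCount (dist_le_coarse)
open Summit.QuantumFields.YangMills.Theorems.Prop7SectET3Transport (periodsT3)
open Summit.QuantumFields.YangMills.Theorems.Prop7SectET3HilbertLetters (W₂ toL2 toL2S DL2 DstarL2)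
open Summit.QuantumFields.YangMills.Theorems.Prop7SectET3WilsonHessian (DeltaEta DeltaEtaSlot)
open Summit.QuantumFields.YangMills.Theorems.Prop7SectET3GaugeProjector (RS)
open Summit.QuantumFields.YangMills.Theorems.Prop7SectET3CurvedPropagators (laplaceA Qk)
open Summit.QuantumFields.YangMills.Theorems.Prop7BlockDistanceWeights (sitesPerDir_zero_eq_mul_pow eta_mul_pow_eq_one tdist_src_tgt_le_one tdist_coarse_comm tdist_coarse_triangle)
open Summit.QuantumFields.YangMills.Theorems.Prop7OneFormAgmonConj (hVconj_of_letters)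
open Literature.MathematicalPhysics.QuantumFieldTheory.Balaban1983to89.Beta.CombesThomasForm (abs_exp_sub_one_le)
open Literature.Analysis.ODE (exp_sub_one_le_mul_exp)

/-! ## §1 Torus geometry and two elementary exponential rows -/

section Geometry

variable {P : Params}

/-- ★ **EXPANSION OF THE `k`-FOLD BLOCK MAP**: `tdist x y ≤ L^k·tdist(B^k x, B^k y) + d·(L^k − 1)` — two fine sites are at most `L^k` coarse steps plus the block diameter apart
(lit-side ✓`CollarCount.dist_le_coarse` per coordinate at modulus ratio `L^k`; labels of `B^k x` = labels of `x` div `L^k`, ✓`val_iterBlockOf`). [cite: Balaban1985Averaging, (2) p.17] -/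
theorem tdist_le_iterBlockOf {k : ℕ} (hk : k ≤ P.m + P.K) (x y : Site P 0) :
    Site.tdist x y ≤ P.L ^ k * Site.tdist (iterBlockOf k x) (iterBlockOf k y) + P.d * (P.L ^ k - 1) := by
  have hL : 0 < P.L ^ k := pow_pos P.L_pos k
  have hn : P.sitesPerDir 0 = P.sitesPerDir k * P.L ^ k := sitesPerDir_zero_eq_mul_pow k hk
  have hcoord : ∀ μ : Fin P.d, min (x μ - y μ).val (y μ - x μ).val ≤
      P.L ^ k * min ((iterBlockOf k x) μ - (iterBlockOf k y) μ).val ((iterBlockOf k y) μ - (iterBlockOf k x) μ).val + (P.L ^ k - 1) :=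
    fun μ => dist_le_coarse hn hL (x μ) (y μ) _ _ (val_iterBlockOf k hk x μ) (val_iterBlockOf k hk y μ)
  unfold Site.tdist
  calc ∑ μ, min (x μ - y μ).val (y μ - x μ).val
      ≤ ∑ μ, (P.L ^ k * min ((iterBlockOf k x) μ - (iterBlockOf k y) μ).val ((iterBlockOf k y) μ - (iterBlockOf k x) μ).val + (P.L ^ k - 1)) :=
        Finset.sum_le_sum fun μ _ => hcoord μ
    _ = P.L ^ k * ∑ μ, min ((iterBlockOf k x) μ - (iterBlockOf k y) μ).val ((iterBlockOf k y) μ - (iterBlockOf k x) μ).val + P.d * (P.L ^ k - 1) := by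
        rw [Finset.sum_add_distrib, Finset.mul_sum]; simp

/-- `1 + T ≤ e^{βT}∕β` for `0 < β ≤ 1`. [folklore] -/
theorem one_add_le_exp_div {β : ℝ} (hβ : 0 < β) (hβ1 : β ≤ 1) (T : ℝ) : 1 + T ≤ Real.exp (β * T) / β := by
  rw [le_div_iff₀ hβ]
  have h := Real.add_one_le_exp (β * T)
  nlinarith

end Geometry

/-! ## §2 The weight rows of a fine-Lipschitz exponent -/

section Rows

variable (F : T3Family) {n K : ℕ} (h : n ≤ K)

/-- **COARSE LIPSCHITZ FROM FINE LIPSCHITZ**: `|φ x − φ x′| ≤ μη·tdist x x′` ⟹ `|φ x − φ x′| ≤ μ·(tdist(Bx, Bx′) + d)` (§1 expansion at `k = K − n`, `η·L^{K−n} = 1`).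
[cite: Balaban1985Averaging, (2) p.17; Balaban1985BackgroundPropagators, (3.49) p.399] -/
theorem abs_sub_le_coarse (φ : Site (F.P K) 0 → ℝ) {μ : ℝ} (hμ : 0 ≤ μ)
    (hφ' : ∀ x x' : Site (F.P K) 0, |φ x - φ x'| ≤ μ * eta F n K * (Site.tdist x x' : ℝ)) (x x' : Site (F.P K) 0) :
    |φ x - φ x'| ≤ μ * ((Site.tdist (P := F.P K) (iterBlockOf (K - n) x) (iterBlockOf (K - n) x') : ℝ) + (F.P K).d) := by
  have hk : K - n ≤ (F.P K).m + (F.P K).K := by show K - n ≤ F.m + K; have := F.hm; omega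
  have hη : 0 < eta F n K := eta_pos F n K
  have hηℓ : eta F n K * (F.L : ℝ) ^ (K - n) = 1 := eta_mul_pow_eq_one F (n := n) (K := K)
  have hLL : ((F.P K).L : ℝ) = F.L := rfl
  have hexp := tdist_le_iterBlockOf hk x x'
  have hcast : (Site.tdist x x' : ℝ) ≤ (F.L : ℝ) ^ (K - n) * (Site.tdist (P := F.P K) (iterBlockOf (K - n) x) (iterBlockOf (K - n) x') : ℝ)
      + (F.P K).d * (F.L : ℝ) ^ (K - n) := by
    have h1 : (Site.tdist x x' : ℝ) ≤ (((F.P K).L ^ (K - n) * Site.tdist (P := F.P K) (iterBlockOf (K - n) x) (iterBlockOf (K - n) x') + (F.P K).d * ((F.P K).L ^ (K - n) - 1) : ℕ) : ℝ) := by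
      exact_mod_cast hexp
    have h2 : ((((F.P K).L ^ (K - n) - 1 : ℕ)) : ℝ) ≤ (F.L : ℝ) ^ (K - n) := by
      have : ((F.P K).L ^ (K - n) - 1 : ℕ) ≤ (F.P K).L ^ (K - n) := Nat.sub_le _ _
      rw [← hLL]; exact_mod_cast this
    push_cast at h1
    rw [hLL] at h1
    nlinarith [h1, h2, Nat.cast_nonneg (α := ℝ) (F.P K).d]
  calc |φ x - φ x'| ≤ μ * eta F n K * (Site.tdist x x' : ℝ) := hφ' x x'
    _ ≤ μ * eta F n K * ((F.L : ℝ) ^ (K - n) * (Site.tdist (P := F.P K) (iterBlockOf (K - n) x) (iterBlockOf (K - n) x') : ℝ) + (F.P K).d * (F.L : ℝ) ^ (K - n)) :=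
        mul_le_mul_of_nonneg_left hcast (mul_nonneg hμ hη.le)
    _ = μ * (eta F n K * (F.L : ℝ) ^ (K - n)) * ((Site.tdist (P := F.P K) (iterBlockOf (K - n) x) (iterBlockOf (K - n) x') : ℝ) + (F.P K).d) := by ring
    _ = μ * ((Site.tdist (P := F.P K) (iterBlockOf (K - n) x) (iterBlockOf (K - n) x') : ℝ) + (F.P K).d) := by rw [hηℓ, mul_one]

/-- ★ **THE FAR-RATIO ROW OF `e^{φ}`** (A2c's `hwfar`): for a fine-Lipschitz `φ` (slope `μη`, `0 ≤ μ`) and any `0 < β ≤ 1`,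
`|e^{φ x}∕e^{φ x′} − 1| ≤ (μ·d·e^{μd}∕β)·e^{(μ+β)·tdist(Bx, Bx′)}` — `e^{t}−1 ≤ te^{t}`, `t ≤ μ(T + d) ≤ μd(1+T) ≤ (μd∕β)e^{βT}`. [cite: Balaban1985BackgroundPropagators, Thm 3.1 (3.46) p.398, (3.49) p.399] -/
theorem far_ratio_exp_le (φ : Site (F.P K) 0 → ℝ) {μ : ℝ} (hμ : 0 ≤ μ)
    (hφ' : ∀ x x' : Site (F.P K) 0, |φ x - φ x'| ≤ μ * eta F n K * (Site.tdist x x' : ℝ)) {β : ℝ} (hβ : 0 < β) (hβ1 : β ≤ 1) (x x' : Site (F.P K) 0) :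
    |Real.exp (φ x) / Real.exp (φ x') - 1|
      ≤ (μ * (F.P K).d * Real.exp (μ * (F.P K).d) / β) * Real.exp ((μ + β) * (Site.tdist (P := F.P K) (iterBlockOf (K - n) x) (iterBlockOf (K - n) x') : ℝ)) := by
  set T : ℝ := (Site.tdist (P := F.P K) (iterBlockOf (K - n) x) (iterBlockOf (K - n) x') : ℝ) with hT
  have hT0 : 0 ≤ T := Nat.cast_nonneg _
  have hd1 : (1 : ℝ) ≤ (F.P K).d := by have := T3Family.P_d F K; norm_cast; omega
  have hc := abs_sub_le_coarse F φ hμ hφ' x x'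
  rw [← hT] at hc
  have hθ0 : 0 ≤ μ * (T + (F.P K).d) := by positivity
  -- `|e^{t} − 1| ≤ e^{θ} − 1 ≤ θ·e^{θ}`
  have h1 : |Real.exp (φ x) / Real.exp (φ x') - 1| ≤ Real.exp (μ * (T + (F.P K).d)) - 1 := by
    rw [← Real.exp_sub]; exact abs_exp_sub_one_le hc
  have h2 : Real.exp (μ * (T + (F.P K).d)) - 1 ≤ μ * (T + (F.P K).d) * Real.exp (μ * (T + (F.P K).d)) := exp_sub_one_le_mul_exp _
  -- `T + d ≤ d(1 + T) ≤ (d∕β)·e^{βT}`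
  have h3 : T + (F.P K).d ≤ (F.P K).d * (Real.exp (β * T) / β) := by
    have := one_add_le_exp_div hβ hβ1 T
    nlinarith [this, hd1, hT0]
  have h4 : Real.exp (μ * (T + (F.P K).d)) = Real.exp (μ * (F.P K).d) * Real.exp (μ * T) := by rw [← Real.exp_add]; ring_nf
  calc |Real.exp (φ x) / Real.exp (φ x') - 1| ≤ μ * (T + (F.P K).d) * Real.exp (μ * (T + (F.P K).d)) := h1.trans h2
    _ ≤ μ * ((F.P K).d * (Real.exp (β * T) / β)) * Real.exp (μ * (T + (F.P K).d)) :=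
        mul_le_mul_of_nonneg_right (mul_le_mul_of_nonneg_left h3 hμ) (Real.exp_pos _).le
    _ = (μ * (F.P K).d * Real.exp (μ * (F.P K).d) / β) * Real.exp ((μ + β) * T) := by
        rw [h4, show (μ + β) * T = β * T + μ * T by ring, Real.exp_add]; field_simp

/-- ★ **THE READ-SET RATIO ROW OF `e^{φ}`** (A2c's `hρQ`): for reference sites `x_r(ĉ)` IN THE SOURCE BLOCK of `ĉ` and a fine bond `b` sourced in `ĉ₋ ∪ ĉ₊`,
`|e^{φ(b₋)}∕e^{φ(x_r ĉ)} − 1|, |e^{φ(x_r ĉ)}∕e^{φ(b₋)} − 1| ≤ e^{μ(d+1)} − 1` (the two blocks are `≤ 1` apart, ✓`tdist_src_tgt_le_one`). [cite: Balaban1985BackgroundPropagators, (3.13)–(3.16) p.393] -/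
theorem readSet_ratio_exp_le (φ : Site (F.P K) 0 → ℝ) {μ : ℝ} (hμ : 0 ≤ μ)
    (hφ' : ∀ x x' : Site (F.P K) 0, |φ x - φ x'| ≤ μ * eta F n K * (Site.tdist x x' : ℝ))
    (xr : PBond (F.P n) 0 → Site (F.P K) 0) (hxr : ∀ c, iterBlockOf (K - n) (xr c) = (bondShift (sites_eq F n K h) c).src)
    (c : PBond (F.P n) 0) (b : PBond (F.P K) 0)
    (hb : iterBlockOf (K - n) b.src = (bondShift (sites_eq F n K h) c).src ∨ iterBlockOf (K - n) b.src = (bondShift (sites_eq F n K h) c).tgt) :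
    |Real.exp (φ b.src) / Real.exp (φ (xr c)) - 1| ≤ Real.exp (μ * ((F.P K).d + 1)) - 1 ∧
      |Real.exp (φ (xr c)) / Real.exp (φ b.src) - 1| ≤ Real.exp (μ * ((F.P K).d + 1)) - 1 := by
  have hT : (Site.tdist (P := F.P K) (iterBlockOf (K - n) b.src) (iterBlockOf (K - n) (xr c)) : ℝ) ≤ 1 := by
    rw [hxr c]
    rcases hb with hs | ht
    · rw [hs]; simp [Site.tdist]
    · rw [ht, tdist_coarse_comm F]
      exact_mod_cast tdist_src_tgt_le_one (bondShift (sites_eq F n K h) c)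
  have hc := abs_sub_le_coarse F φ hμ hφ' b.src (xr c)
  have hθ : |φ b.src - φ (xr c)| ≤ μ * ((F.P K).d + 1) := hc.trans (by nlinarith [hT, hμ])
  have hθ' : |φ (xr c) - φ b.src| ≤ μ * ((F.P K).d + 1) := by rw [abs_sub_comm]; exact hθ
  constructor
  · rw [← Real.exp_sub]; exact abs_exp_sub_one_le hθ
  · rw [← Real.exp_sub]; exact abs_exp_sub_one_le hθ'

end Rows

/-! ## §3 ★★★ A4's `hVconj` at the block-distance exponential weights, from the three member letters -/

section Export

variable (F : T3Family) {n K : ℕ} (h : n ≤ K) (c₀ cB : ℝ) [Fact (0 < c₀)] [Fact (0 < cB)] {a : ℝ}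
  {Δx : GaugeField (F.P K) 0 (Matrix.specialUnitaryGroup (Fin 2) ℂ) → (BondL2K ℂ 3 (periodsT3 F K) c₀ W₂ →ₗ[ℂ] BondL2K ℂ 3 (periodsT3 F K) c₀ W₂)}

/-- ★★★ **THE `hVconj` LETTER OF A4 ✓`Prop7OneFormAgmonExp.agmon_oneForm_exp` ∕ `blockDecay_oneForm_of_letters` AT `w = e^{φ}`, FROM THE MEMBER LETTERS.**  `RegPr F n K ε₀ U₀` + routeR-w4's
windows, `0 ≤ a`; an exponent `φ` with the per-bond slope `|φ(b₊) − φ(b₋)| ≤ θ` (A4's `hφ`) and the fine-Lipschitz row `|φ x − φ x′| ≤ μη·tdist x x′` (px12 ✓`exists_blockDistanceWeight` (i)∕(i′),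
`θ = μη`); reference sites `x_r(ĉ)` in the source blocks; `0 < β ≤ 1` with `μ + β < μ′`; and the letters `hk` (the `h349` kernel row, `Ck`, `μ′`), `hQ` (`‖Q_kv‖ ≤ C_Q‖v‖`), `hslot` (`θ_S`).
THEN A4's `hVconj` holds with `θ_V = a·(2√κ²·C_Q + κ²) + √2·Ck·(μde^{μd}∕β)·(d(L^d)^{K−n}(2(1+1∕(μ′−(μ+β))))³) + θ_S + 32√2·ε₀·d·6^d·(1+(1+(e^{θ}−1))²)`, `κ² = 216(e^{μ(d+1)}−1)²(cB∕(c₀ℓ³))` —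
K-FREE at the pins and `→ θ_S` as `μ, θ → 0`. [cite: Balaban1985BackgroundPropagators, Thm 3.1 (3.46) p.398, (3.49) p.399, Thm 3.12 p.422; Balaban1985Variational, (134)–(136) p.298; Agmon1982, Ch. 1] -/
theorem hVconj_exp_of_letters {ε₀ : ℝ} (hε₀ : 0 < ε₀) (hε : 10 ^ 10 * (F.L : ℝ) ^ 6 * ε₀ ≤ 1) (hε12 : 10 ^ 12 * (F.L : ℝ) ^ 3 * ε₀ ≤ 1)
    (U₀ : GaugeField (F.P K) 0 (Matrix.specialUnitaryGroup (Fin 2) ℂ)) (hreg : RegPr F n K ε₀ U₀) (ha : 0 ≤ a)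
    (φ : Site (F.P K) 0 → ℝ) {θ μ : ℝ} (hμ : 0 ≤ μ)
    (hφ : ∀ b : PBond (F.P K) 0, |φ b.tgt - φ b.src| ≤ θ)
    (hφ' : ∀ x x' : Site (F.P K) 0, |φ x - φ x'| ≤ μ * eta F n K * (Site.tdist x x' : ℝ))
    (xr : PBond (F.P n) 0 → Site (F.P K) 0) (hxr : ∀ c, iterBlockOf (K - n) (xr c) = (bondShift (sites_eq F n K h) c).src)
    {β μ' Ck : ℝ} (hβ : 0 < β) (hβ1 : β ≤ 1) (hνμ : μ + β < μ') (hCk : 0 ≤ Ck)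
    (hk : ∀ (b : PBond (F.P K) 0) (Z : Matrix (Fin 2) (Fin 2) ℂ) (bd : PBond (F.P K) 0),
      ‖(toL2 F K c₀).symm (DL2 F n K c₀ U₀ (DstarL2 F n K c₀ U₀ (toL2 F K c₀ (Pi.single b Z)) - RS F n K h c₀ cB U₀ (DstarL2 F n K c₀ U₀ (toL2 F K c₀ (Pi.single b Z))))) bd‖
        ≤ Ck * Real.exp (-(μ' * (Site.tdist (P := F.P K) (iterBlockOf (K - n) b.src) (iterBlockOf (K - n) bd.src) : ℝ))) * ‖Z‖)
    {CQ : ℝ} (hQ : ∀ v : BondL2K ℂ 3 (periodsT3 F K) c₀ W₂, ‖Qk F n K h c₀ cB U₀ v‖ ≤ CQ * ‖v‖)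
    {θS : ℝ} (hslot : ∀ X : PBond (F.P K) 0 → Matrix (Fin 2) (Fin 2) ℂ,
      RCLike.re ⟪toL2 F K c₀ X, (Δx U₀ - (DeltaEta F n K c₀ U₀ : BondL2K ℂ 3 (periodsT3 F K) c₀ W₂ →ₗ[ℂ] BondL2K ℂ 3 (periodsT3 F K) c₀ W₂)) (toL2 F K c₀ X)⟫_ℂ
          - θS * ‖toL2 F K c₀ X‖ ^ 2
        ≤ RCLike.re ⟪toL2 F K c₀ (fun b => Real.exp (φ b.src) • X b),
            (Δx U₀ - (DeltaEta F n K c₀ U₀ : BondL2K ℂ 3 (periodsT3 F K) c₀ W₂ →ₗ[ℂ] BondL2K ℂ 3 (periodsT3 F K) c₀ W₂)) (toL2 F K c₀ (fun b => (Real.exp (φ b.src))⁻¹ • X b))⟫_ℂ) :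
    ∀ X : PBond (F.P K) 0 → Matrix (Fin 2) (Fin 2) ℂ,
      RCLike.re ⟪toL2 F K c₀ X, laplaceA F n K h c₀ cB a Δx U₀ (toL2 F K c₀ X)⟫_ℂ
          - (∑ μ : Fin (F.P K).d, ‖DL2 F n K c₀ U₀ (toL2S F K c₀ (formComp X μ))‖ ^ 2)
          - (a * (2 * Real.sqrt (216 * (Real.exp (μ * ((F.P K).d + 1)) - 1) ^ 2 * (cB / (c₀ * ((F.L : ℝ) ^ (K - n)) ^ 3))) * CQ
                  + 216 * (Real.exp (μ * ((F.P K).d + 1)) - 1) ^ 2 * (cB / (c₀ * ((F.L : ℝ) ^ (K - n)) ^ 3)))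
              + Real.sqrt 2 * Ck * (μ * (F.P K).d * Real.exp (μ * (F.P K).d) / β)
                  * (((F.P K).d : ℝ) * ((((F.P K).L : ℝ) ^ (F.P K).d) ^ (K - n)) * (2 * (1 + 1 / (μ' - (μ + β)))) ^ 3)
              + θS + 32 * Real.sqrt 2 * ε₀ * (((F.P K).d : ℝ) * (2 * 3) ^ (F.P K).d) * (1 + (1 + (Real.exp θ - 1)) ^ 2)) * ‖toL2 F K c₀ X‖ ^ 2
        ≤ RCLike.re ⟪toL2 F K c₀ (fun b => Real.exp (φ b.src) • X b), laplaceA F n K h c₀ cB a Δx U₀ (toL2 F K c₀ (fun b => (Real.exp (φ b.src))⁻¹ • X b))⟫_ℂ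
          - RCLike.re (∑ μ : Fin (F.P K).d, ⟪DL2 F n K c₀ U₀ (toL2S F K c₀ (formComp (fun b => Real.exp (φ b.src) • X b) μ)),
              DL2 F n K c₀ U₀ (toL2S F K c₀ (formComp (fun b => (Real.exp (φ b.src))⁻¹ • X b) μ))⟫_ℂ) := by
  have hρ : ∀ b : PBond (F.P K) 0, |Real.exp (φ b.tgt) / Real.exp (φ b.src) - 1| ≤ Real.exp θ - 1 := fun b => by
    rw [← Real.exp_sub]; exact abs_exp_sub_one_le (hφ b)
  have hρ' : ∀ b : PBond (F.P K) 0, |Real.exp (φ b.src) / Real.exp (φ b.tgt) - 1| ≤ Real.exp θ - 1 := fun b => by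
    rw [← Real.exp_sub]; exact abs_exp_sub_one_le (by rw [abs_sub_comm]; exact hφ b)
  have hθc : 0 ≤ μ * (F.P K).d * Real.exp (μ * (F.P K).d) / β := by positivity
  exact hVconj_of_letters F h c₀ cB hε₀ hε hε12 U₀ hreg ha (fun x => Real.exp (φ x)) (fun _ => Real.exp_pos _) hρ hρ' xr
    (fun c b hb => readSet_ratio_exp_le F h φ hμ hφ' xr hxr c b hb) hθc hCk hνμ
    (fun x x' => far_ratio_exp_le F φ hμ hφ' hβ hβ1 x x') hk hQ hslot

end Export

end Summit.QuantumFields.YangMills.Theorems.Prop7OneFormAgmonWeights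

end
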